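import Literature.NumberTheory.Automorphic.UnitaryGroupArthurTruncatedKernel
import Literature.NumberTheory.Automorphic.AdelicHeightZetaConvergence
import Literature.NumberTheory.Automorphic.AdelicVectorHeightBound
import HarnessLib

/-!
# «The sums over `δ` are finite»: for `U(3)` only finitely many `δ ∈ B(F)\G(F)` have `H(δ x) > T`,
# so Arthur's truncation `Λ^T φ` and truncated kernel `k^T` are honest finite sums
(Rogawski, *Automorphic Representations of Unitary Groups in Three Variables* (1990), §2.2, p. 13:
«The sums over `δ` and `γ` in the definition of `k^T(x)` are finite»; Garrett, *Modern Analysis of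
Automorphic Forms by Example* (2018), §2.2–§2.3 (reduction theory via heights), §2.10)

Topic `NumberTheory/Automorphic`; namespace `Literature.NumberTheory.Automorphic` (§1, `GL_n`) and
`Literature.NumberTheory.Automorphic.UnitaryGroup` (§§2–3). THEOREMS ONLY over accepted tree modules:
no definition, no named fact, no `sorry`, no instance, no notation.

* §1 (`GL_n` over a number field `K`; Northcott from the height zeta function).
  `finite_setOf_vecHeight_ratVec_vecMul_le`: for `g ∈ GL_n(𝔸_K)` and a bound `B`, only finitely many
  lines `[ξ] ∈ ℙ^{n−1}(K)` have Godement–Garrett height `h(ξ g) ≤ B` — the terms `h(ξ g)^{−τ} ≥ B^{−τ}`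
  of the CONVERGENT height zeta function ★ `summable_vecHeight_rpow_neg` (`τ > n`) can occur only
  finitely often [Garrett2018, §2.2–§2.3; Schanuel].
* §2 (`U(J₃)`, `F`-rank one). For `γ ∈ G(F) = U(J₃)(F)` the last row `e₃ γ` is a non-zero rational
  vector whose line `[e₃ γ] ∈ ℙ²(E)` depends only on the coset `B(F) γ`, and **`B(F) γ ↦ [e₃ γ]` is
  INJECTIVE** (`mem_borelAdelic_toAdelic_of_lastRow_eq_smul`: a unitary `γ` whose last row is
  `(0, 0, a)` is upper triangular — its inverse has first column `∝ e₁` by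
  ★ `coe_inv_apply_of_mem_unitaryGroupOfForm_antidiagonal`); and `H(γ x) = h(e₃ γ · x)⁻¹`
  (★ `borelHeight`, `lastRow_mul`).
* §3 Hence **`finite_setOf_lt_borelHeight`**: for `x ∈ G(𝔸_F)` and `T > 0` the set
  `{δ ∈ B(F)\G(F) : H(δ x) > T}` is FINITE; consequently the pseudo-Eisenstein sums
  `Σ_{δ} c_B^T φ(δ g)` and `Σ_{δ} 1_{H(δx) > T} K_B(δ x, δ x)` defining ★ `truncation` (`Λ^T φ`) and
  ★ `truncatedKernel` (`k^T`) have FINITE support for every `φ`, `f`, `ν`, `𝓕`, `x` and `T > 0`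
  (`finite_support_constantTermTail_translate`, `finite_support_kernelBorelTail_translate`): the
  `finsum`s of the accepted letters are genuine finite sums (`truncation_eq_sub_sum`,
  `truncatedKernel_eq_sub_sum`), as print asserts.
* §4 (every `N`). `borelHeight_rational_mul_le`: `H(γ x) ≤ H_mat(x⁻¹)` for all `γ ∈ G(F)`
  (★ `one_le_matHeightBound_mul_vecHeight`: heights of `E^N x ∖ 0` are bounded below), so
  `k^T(x) = K(x, x)` and `Λ^T φ(x) = φ(x)` once `T ≥ H_mat(x⁻¹)` [Shokranian1992, Example (5.2)].

## References

* J. D. Rogawski, *Automorphic Representations of Unitary Groups in Three Variables*, Annals of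
  Mathematics Studies 123 (1990), §2.2 (p. 13) [Rogawski1990].
* P. Garrett, *Modern Analysis of Automorphic Forms by Example* (2018), §2.2 (heights on `GL_n`,
  Thm. 2.2.2), §2.3 (reduction: finitely many `γ` with large height), §2.10 (`Λ^T`) [Garrett2018].
-/

noncomputable section

open MeasureTheory NumberField IsDedekindDomain Matrix
open scoped NNReal ENNReal MatrixGroups

namespace Literature.NumberTheory.Automorphic

/-! ## §1 Northcott's finiteness from the convergence of the height zeta function -/

section Northcott

variable (K : Type) [Field K] [NumberField K] {m : ℕ}

/-- **Only finitely many rational lines have bounded twisted height**: for `g ∈ GL_n(𝔸_K)` and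
`B ≥ 0`, `{[ξ] ∈ ℙ^{n−1}(K) : h(ξ g) ≤ B}` is finite. Proof: the height zeta function
`Σ_{[ξ]} h(ξ g)^{−τ}` converges for `τ = n + 1` (★ `summable_vecHeight_rpow_neg`), its terms tend to
`0` along the cofinite filter, while `h(ξ g) ≤ B` forces `h(ξ g)^{−τ} ≥ B^{−τ} > 0` (heights of
non-zero rational vectors are positive, ★ `vecHeight_ratVec_vecMul_pos`). [cite: Garrett2018, §2.2 Thm. 2.2.2 and §2.3] -/
theorem finite_setOf_vecHeight_ratVec_vecMul_le (g : GL (Fin (m + 1)) (AdeleRing (𝓞 K) K)) (B : ℝ≥0) :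
    {p : Projectivization K (Fin (m + 1) → K) |
      vecHeight K (ratVec K p.rep ᵥ* (g : Matrix (Fin (m + 1)) (Fin (m + 1)) (AdeleRing (𝓞 K) K))) ≤ B}.Finite := by
  have hτ : (m + 1 : ℝ) < (m + 2 : ℝ) := by linarith
  have hs := summable_vecHeight_rpow_neg K g hτ
  by_cases hB : B = 0
  · refine Set.Finite.subset (Set.finite_empty) fun p hp => ?_
    have hpos := vecHeight_ratVec_vecMul_pos K (Projectivization.rep_nonzero p) g
    have hp' : vecHeight K (ratVec K p.rep ᵥ* (g : Matrix (Fin (m + 1)) (Fin (m + 1)) (AdeleRing (𝓞 K) K))) ≤ 0 := by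
      simpa only [hB, Set.mem_setOf_eq] using hp
    exact absurd (le_zero_iff.1 hp') hpos.ne'
  · have hBpos : (0 : ℝ) < (B : ℝ) := by
      have : (0 : ℝ≥0) < B := pos_iff_ne_zero.2 hB
      exact_mod_cast this
    set ε : ℝ := (B : ℝ) ^ (-(m + 2 : ℝ)) with hε
    have hεpos : 0 < ε := Real.rpow_pos_of_pos hBpos _
    have hev := hs.tendsto_cofinite_zero.eventually (gt_mem_nhds hεpos)
    refine (Filter.eventually_cofinite.1 hev).subset fun p hp => ?_
    simp only [Set.mem_setOf_eq, not_lt] at hp ⊢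
    have hpos := vecHeight_ratVec_vecMul_pos K (Projectivization.rep_nonzero p) g
    have hpos' : (0 : ℝ) < (vecHeight K (ratVec K p.rep ᵥ*
        (g : Matrix (Fin (m + 1)) (Fin (m + 1)) (AdeleRing (𝓞 K) K))) : ℝ) := by exact_mod_cast hpos
    have hle : ((vecHeight K (ratVec K p.rep ᵥ*
        (g : Matrix (Fin (m + 1)) (Fin (m + 1)) (AdeleRing (𝓞 K) K))) : ℝ≥0) : ℝ) ≤ (B : ℝ) := by
      exact_mod_cast hp
    rw [hε]
    exact Real.rpow_le_rpow_of_nonpos hpos' hle (by linarith)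

end Northcott

namespace UnitaryGroup

variable {F E : Type} [Field F] [NumberField F] [Field E] [NumberField E] [Algebra F E]
  {c : E ≃ₐ[F] E}

/-! ## §2 `U(J₃)`: the last row of a rational element and the injection `B(F)\G(F) ↪ ℙ²(E)` -/

/-- The last row `e₃ γ ∈ E³` of the rational matrix of `γ ∈ U(J₃)(F)` (a plain function, no new
definition: `fun j => γ ⊤ j`) is non-zero — `γ` is invertible. [cite: Garrett2018, §2.2 (PDF p. 83)] -/
theorem lastRow_rational_ne_zero {N : ℕ} [NeZero N] (γ : (quasiSplit F E c N).Rational) :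
    (fun j : Fin N => ((γ.1 : GL (Fin N) E) : Matrix (Fin N) (Fin N) E) ⊤ j) ≠ 0 := by
  intro h
  have h1 : (((γ.1 : GL (Fin N) E) : Matrix (Fin N) (Fin N) E) * ((γ.1 : GL (Fin N) E)⁻¹ : GL (Fin N) E)) ⊤ ⊤ = 1 := by
    rw [← Units.val_mul, mul_inv_cancel, Units.val_one, Matrix.one_apply_eq]
  rw [Matrix.mul_apply] at h1
  have h0 : ∀ k : Fin N, ((γ.1 : GL (Fin N) E) : Matrix (Fin N) (Fin N) E) ⊤ k = 0 := fun k => congrFun h k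
  simp only [h0, zero_mul, Finset.sum_const_zero] at h1
  exact zero_ne_one h1

/-- **The last row of the adelic image of `γ ∈ G(F)` is the principal adele of its rational last
row**: `lastRow (toAdelic γ) = principalVec (e₃ γ)` (definitional). [cite: Garrett2018, §2.2 (PDF p. 83)] -/
theorem lastRow_toAdelic {N : ℕ} [NeZero N] (γ : (quasiSplit F E c N).Rational) :
    lastRow ((quasiSplit F E c N).toAdelic γ) =
      principalVec E (fun j : Fin N => ((γ.1 : GL (Fin N) E) : Matrix (Fin N) (Fin N) E) ⊤ j) := rfl

/-- **A rational unitary matrix of `U(J₃)` whose last row is `(0, 0, a)` is upper triangular**, i.e.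
its adelic image lies in `B(𝔸_F)`: the entries `(2,0), (2,1)` vanish by hypothesis, and `(1,0)`
because the INVERSE has first column `∝ e₁` — `(γ⁻¹)_{ij} = c(γ_{rev j, rev i})`
(★ `coe_inv_apply_of_mem_unitaryGroupOfForm_antidiagonal`) gives `(γ⁻¹)_{10} = c(γ_{21}) = 0`,
`(γ⁻¹)_{20} = c(γ_{20}) = 0`, so `(γ γ⁻¹)_{10} = γ_{10} (γ⁻¹)_{00} = 0` with `(γ⁻¹)_{00} ≠ 0` from
`(γ γ⁻¹)_{00} = 1`. For `N = 3` the stabiliser of the isotropic line is the Borel subgroup (Rogawski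
(1990), §1.10). [cite: Rogawski1990, §1.10] -/
theorem mem_borelAdelic_toAdelic_of_lastRow_eq_smul {γ : (quasiSplit F E c 3).Rational} {a : E}
    (h : (fun j : Fin 3 => ((γ.1 : GL (Fin 3) E) : Matrix (Fin 3) (Fin 3) E) ⊤ j) = a • Pi.single (⊤ : Fin 3) (1 : E)) :
    (quasiSplit F E c 3).toAdelic γ ∈ borelAdelic F E c 3 := by
  set A : Matrix (Fin 3) (Fin 3) E := ((γ.1 : GL (Fin 3) E) : Matrix (Fin 3) (Fin 3) E) with hA
  set Ai : Matrix (Fin 3) (Fin 3) E := (((γ.1 : GL (Fin 3) E)⁻¹ : GL (Fin 3) E) : Matrix (Fin 3) (Fin 3) E) with hAi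
  have htop : (⊤ : Fin 3) = 2 := rfl
  -- the given zeros of the last row
  have h20 : A 2 0 = 0 := by
    have := congrFun h 0; rw [htop] at this
    simpa using this
  have h21 : A 2 1 = 0 := by
    have := congrFun h 1; rw [htop] at this
    simpa using this
  -- entries of the inverse
  have hinv : ∀ i j : Fin 3, Ai i j = (c : E →+* E) (A (Fin.rev j) (Fin.rev i)) := fun i j =>
    coe_inv_apply_of_mem_unitaryGroupOfForm_antidiagonal (c : E →+* E) 3 γ.2 i j
  have hi10 : Ai 1 0 = 0 := by
    rw [hinv]; change (c : E →+* E) (A 2 1) = 0; rw [h21, map_zero]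
  have hi20 : Ai 2 0 = 0 := by
    rw [hinv]; change (c : E →+* E) (A 2 0) = 0; rw [h20, map_zero]
  have hmul : A * Ai = 1 := by
    rw [hA, hAi, ← Units.val_mul, mul_inv_cancel, Units.val_one]
  have h00 : A 0 0 * Ai 0 0 = 1 := by
    have := congrFun (congrFun hmul 0) 0
    rw [Matrix.mul_apply, Fin.sum_univ_three, hi10, hi20, mul_zero, mul_zero, add_zero, add_zero,
      Matrix.one_apply_eq] at this
    exact this
  have h10 : A 1 0 = 0 := by
    have := congrFun (congrFun hmul 1) 0
    rw [Matrix.mul_apply, Fin.sum_univ_three, hi10, hi20, mul_zero, mul_zero, add_zero, add_zero,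
      Matrix.one_apply_ne (by decide)] at this
    rcases mul_eq_zero.1 this with h' | h'
    · exact h'
    · exfalso; rw [h', mul_zero] at h00; exact zero_ne_one h00
  -- upper triangularity of the adelic image
  rw [mem_borelAdelic_iff]
  intro i j hij
  change algebraMap E (AdeleRing (𝓞 E) E) (A i j) = 0
  have hz : A i j = 0 := by
    fin_cases i <;> fin_cases j <;> simp_all (config := {decide := true})
  rw [hz, map_zero]

/-- The rational line `[e₃ γ] ∈ ℙ²(E)` of a coset `B(F) γ` (read at the representative `Quotient.out`,
rational matrix chosen by `toAdelic.range`): this is Garrett's parametrisation of `P(F)\G(F)` by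
rational isotropic lines, the index set of Eisenstein / pseudo-Eisenstein sums. We do not introduce a
definition; the next two theorems use the expression inline. **Injectivity**: if `[e₃ γ] = [e₃ γ']`
then `γ' γ⁻¹` has last row `∝ e₃`, hence lies in `B(F)` (`mem_borelAdelic_toAdelic_of_lastRow_eq_smul`),
so `B(F) γ = B(F) γ'`. [cite: Garrett2018, §2.2 (PDF p. 83)] -/
theorem rightRel_of_lastRow_eq_smul {γ γ' : (quasiSplit F E c 3).Rational} {a : Eˣ}
    (h : (fun j : Fin 3 => ((γ'.1 : GL (Fin 3) E) : Matrix (Fin 3) (Fin 3) E) ⊤ j) =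
      (a : E) • fun j : Fin 3 => ((γ.1 : GL (Fin 3) E) : Matrix (Fin 3) (Fin 3) E) ⊤ j) :
    (quasiSplit F E c 3).toAdelic (γ' * γ⁻¹) ∈ borelAdelic F E c 3 := by
  refine mem_borelAdelic_toAdelic_of_lastRow_eq_smul (a := (a : E)) ?_
  -- last row of `γ' γ⁻¹` is `(e₃ γ') ᵥ* γ⁻¹ = a • (e₃ γ ᵥ* γ⁻¹) = a • e₃`
  funext j
  have hrow : (fun k : Fin 3 => (((γ' * γ⁻¹ : (quasiSplit F E c 3).Rational).1 : GL (Fin 3) E) :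
      Matrix (Fin 3) (Fin 3) E) ⊤ k) =
      (fun k : Fin 3 => ((γ'.1 : GL (Fin 3) E) : Matrix (Fin 3) (Fin 3) E) ⊤ k) ᵥ*
        (((γ.1 : GL (Fin 3) E)⁻¹ : GL (Fin 3) E) : Matrix (Fin 3) (Fin 3) E) := by
    funext k
    change (((γ'.1 * γ.1⁻¹ : GL (Fin 3) E)) : Matrix (Fin 3) (Fin 3) E) ⊤ k = _
    rw [Units.val_mul, Matrix.mul_apply, Matrix.vecMul, dotProduct]
  have hid : (fun k : Fin 3 => ((γ.1 : GL (Fin 3) E) : Matrix (Fin 3) (Fin 3) E) ⊤ k) ᵥ*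
      (((γ.1 : GL (Fin 3) E)⁻¹ : GL (Fin 3) E) : Matrix (Fin 3) (Fin 3) E) = Pi.single (⊤ : Fin 3) 1 := by
    funext k
    have := congrFun (congrFun (show ((γ.1 : GL (Fin 3) E) : Matrix (Fin 3) (Fin 3) E) *
      (((γ.1 : GL (Fin 3) E)⁻¹ : GL (Fin 3) E) : Matrix (Fin 3) (Fin 3) E) = 1 by
        rw [← Units.val_mul, mul_inv_cancel, Units.val_one]) ⊤) k
    rw [Matrix.mul_apply] at this
    rw [Matrix.vecMul, dotProduct, this, Matrix.one_apply, Pi.single_apply]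
    simp only [eq_comm]
  rw [show (((γ' * γ⁻¹ : (quasiSplit F E c 3).Rational).1 : GL (Fin 3) E) : Matrix (Fin 3) (Fin 3) E) ⊤ j =
      (fun k : Fin 3 => (((γ' * γ⁻¹ : (quasiSplit F E c 3).Rational).1 : GL (Fin 3) E) :
        Matrix (Fin 3) (Fin 3) E) ⊤ k) j from rfl, hrow, h, Matrix.smul_vecMul, hid]

/-! ## §3 Finiteness of `{δ ∈ B(F)\G(F) : H(δ x) > T}` and of the pseudo-Eisenstein sums -/

/-- **«The sums over `δ` are finite»**: for `x ∈ U(J₃)(𝔸_F)` and `T > 0` only finitely many cosets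
`δ ∈ B(F)\G(F)` have `H(δ x) > T`. Proof: `H(δ x) = h(e₃ δ · x)⁻¹` (★ `borelHeight`, `lastRow_mul`),
`δ ↦ [e₃ δ] ∈ ℙ²(E)` is injective on `B(F)\G(F)` (§2), and only finitely many rational lines have
`h([ξ] x) ≤ T⁻¹` (§1). (Rogawski (1990), §2.2 p. 13; Garrett (2018), §2.3: reduction theory.)
[cite: Rogawski1990, §2.2 (p. 13)] -/
theorem finite_setOf_lt_borelHeight (x : (quasiSplit F E c 3).Adelic) {T : ℝ≥0} (hT : 0 < T) :
    {q : Quotient (QuotientGroup.rightRel (arithmeticBorel F E c 3)) |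
      T < borelHeight (((q.out : (quasiSplit F E c 3).arithmeticSubgroup) : (quasiSplit F E c 3).Adelic) * x)}.Finite := by
  classical
  -- rational representatives
  have hrep : ∀ δ : (quasiSplit F E c 3).arithmeticSubgroup,
      ∃ γ : (quasiSplit F E c 3).Rational, (quasiSplit F E c 3).toAdelic γ = δ := fun δ => δ.2
  choose ρ hρ using hrep
  let row : (quasiSplit F E c 3).Rational → Fin 3 → E :=
    fun γ j => ((γ.1 : GL (Fin 3) E) : Matrix (Fin 3) (Fin 3) E) ⊤ j
  have hrow0 : ∀ γ, row γ ≠ 0 := fun γ => lastRow_rational_ne_zero γ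
  -- the line map `q ↦ [e₃ ρ(q.out)]`
  let ℓ : Quotient (QuotientGroup.rightRel (arithmeticBorel F E c 3)) → Projectivization E (Fin 3 → E) :=
    fun q => Projectivization.mk E (row (ρ q.out)) (hrow0 _)
  -- injectivity
  have hinj : Function.Injective ℓ := by
    intro q q' hqq
    obtain ⟨a, ha⟩ := (Projectivization.mk_eq_mk_iff E _ _ (hrow0 _) (hrow0 _)).1 hqq
    -- `ha : a • row (ρ q'.out) = row (ρ q.out)`
    have hB : (quasiSplit F E c 3).toAdelic (ρ q.out * (ρ q'.out)⁻¹) ∈ borelAdelic F E c 3 :=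
      rightRel_of_lastRow_eq_smul (γ := ρ q'.out) (γ' := ρ q.out) (a := a) (by
        funext j; exact (congrFun ha j).symm)
    have hmem : q.out * q'.out⁻¹ ∈ arithmeticBorel F E c 3 := by
      rw [mem_arithmeticBorel_iff, Subgroup.coe_mul, Subgroup.coe_inv, ← hρ q.out, ← hρ q'.out,
        ← map_inv, ← map_mul]
      exact hB
    have hmem' : q'.out * q.out⁻¹ ∈ arithmeticBorel F E c 3 := by
      have h' := Subgroup.inv_mem _ hmem
      rwa [_root_.mul_inv_rev, inv_inv] at h'
    rw [← Quotient.out_eq q, ← Quotient.out_eq q']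
    exact Quotient.sound (QuotientGroup.rightRel_apply.2 hmem')
  -- heights: `H(q.out x) = h([ℓ q] x)⁻¹`
  set g : GL (Fin 3) (AdeleRing (𝓞 E) E) := adelicVal F E c 3 _ x with hg
  have hH : ∀ q : Quotient (QuotientGroup.rightRel (arithmeticBorel F E c 3)),
      vecHeight E (ratVec E (ℓ q).rep ᵥ* (g : Matrix (Fin 3) (Fin 3) (AdeleRing (𝓞 E) E))) =
        (borelHeight (((q.out : (quasiSplit F E c 3).arithmeticSubgroup) : (quasiSplit F E c 3).Adelic) * x))⁻¹ := by
    intro q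
    obtain ⟨u, hu⟩ := Projectivization.exists_smul_eq_mk_rep E (row (ρ q.out)) (hrow0 _)
    have hrat : ratVec E (ℓ q).rep = algebraMap E (AdeleRing (𝓞 E) E) (u : E) • principalVec E (row (ρ q.out)) := by
      funext j
      change algebraMap E (AdeleRing (𝓞 E) E) ((ℓ q).rep j) = _
      rw [← hu, Pi.smul_apply, Pi.smul_apply, principalVec_apply, smul_eq_mul, Units.smul_def, smul_eq_mul,
        map_mul]
    rw [borelHeight_def, inv_inv, ← hρ q.out, lastRow_mul, lastRow_toAdelic, hrat, Matrix.smul_vecMul,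
      vecHeight_smul_algebraMap (isHeightFinite_principalVec_vecMul (hrow0 _) g)]
  -- conclude
  have hfin := finite_setOf_vecHeight_ratVec_vecMul_le E (m := 2) g T⁻¹
  refine (hfin.preimage hinj.injOn).subset fun q hq => ?_
  simp only [Set.mem_preimage, Set.mem_setOf_eq] at hq ⊢
  rw [hH q]
  exact (inv_le_inv₀ (lt_trans hT hq) hT).2 hq.le

section DeltaSum

variable [MeasurableSpace (adelicUnipotent F E c 3)]

/-- **The pseudo-Eisenstein sum of the constant-term tail is a finite sum**: for `T > 0`, every `φ`,
`ν`, `𝓕` and `g`, the family `δ ↦ c_B^T φ(δ g)` on `B(F)\G(F)` has finite support (it vanishes unless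
`H(δ g) > T`). [cite: Garrett2018, §2.10 (PDF p. 119)] -/
theorem finite_support_constantTermTail_translate (ν : Measure (adelicUnipotent F E c 3))
    (𝓕 : Set (adelicUnipotent F E c 3)) {T : ℝ≥0} (hT : 0 < T) (φ : (quasiSplit F E c 3).Adelic → ℂ)
    (g : (quasiSplit F E c 3).Adelic) :
    (Function.support fun q : Quotient (QuotientGroup.rightRel (arithmeticBorel F E c 3)) =>
      constantTermTail ν 𝓕 T φ
        (((q.out : (quasiSplit F E c 3).arithmeticSubgroup) : (quasiSplit F E c 3).Adelic) * g)).Finite := by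
  refine (finite_setOf_lt_borelHeight g hT).subset fun q hq => ?_
  by_contra hlt
  exact hq (constantTermTail_of_not_lt φ hlt)

/-- **The `δ`-sum in `k^T(x)` is a finite sum**: for `T > 0`, every `f`, `ν`, `𝓕` and `x`, the family
`δ ↦ 1_{H(δ x) > T} K_B(δ x, δ x)` on `B(F)\G(F)` has finite support (Rogawski (1990), §2.2 p. 13:
«The sums over `δ` … are finite»). [cite: Rogawski1990, §2.2 (p. 13)] -/
theorem finite_support_kernelBorelTail_translate (ν : Measure (adelicUnipotent F E c 3))
    (𝓕 : Set (adelicUnipotent F E c 3)) {T : ℝ≥0} (hT : 0 < T) (f : (quasiSplit F E c 3).Adelic → ℂ)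
    (x : (quasiSplit F E c 3).Adelic) :
    (Function.support fun q : Quotient (QuotientGroup.rightRel (arithmeticBorel F E c 3)) =>
      kernelBorelTail ν 𝓕 T f
        (((q.out : (quasiSplit F E c 3).arithmeticSubgroup) : (quasiSplit F E c 3).Adelic) * x)).Finite := by
  refine (finite_setOf_lt_borelHeight x hT).subset fun q hq => ?_
  by_contra hlt
  exact hq (kernelBorelTail_of_not_lt f hlt)

/-- **`Λ^T φ(g) = φ(g) − Σ_{δ ∈ S} c_B^T φ(δ g)`, a genuine finite sum** over the finite support `S`
(`T > 0`; the `finsum` of ★ `truncation` is never junk on `U(3)`). [cite: Garrett2018, §2.10 (PDF p. 119)] -/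
theorem truncation_eq_sub_sum (ν : Measure (adelicUnipotent F E c 3)) (𝓕 : Set (adelicUnipotent F E c 3))
    {T : ℝ≥0} (hT : 0 < T) (φ : (quasiSplit F E c 3).Adelic → ℂ) (g : (quasiSplit F E c 3).Adelic) :
    truncation ν 𝓕 T φ g = φ g -
      ∑ q ∈ (finite_support_constantTermTail_translate ν 𝓕 hT φ g).toFinset,
        constantTermTail ν 𝓕 T φ
          (((q.out : (quasiSplit F E c 3).arithmeticSubgroup) : (quasiSplit F E c 3).Adelic) * g) := by
  rw [truncation_def, pseudoEisenstein_def, finsum_eq_sum _ (finite_support_constantTermTail_translate ν 𝓕 hT φ g)]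

/-- **`k^T(x) = K(x, x) − Σ_{δ ∈ S} 1_{H(δx) > T} K_B(δ x, δ x)`, a genuine finite sum** over the finite
support `S` (`T > 0`; the `finsum` of ★ `truncatedKernel` is never junk on `U(3)`).
[cite: Rogawski1990, §2.2 (p. 13)] -/
theorem truncatedKernel_eq_sub_sum (ν : Measure (adelicUnipotent F E c 3))
    (𝓕 : Set (adelicUnipotent F E c 3)) {T : ℝ≥0} (hT : 0 < T) (f : (quasiSplit F E c 3).Adelic → ℂ)
    (x : (quasiSplit F E c 3).Adelic) :
    truncatedKernel ν 𝓕 T f x = kernel f x x -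
      ∑ q ∈ (finite_support_kernelBorelTail_translate ν 𝓕 hT f x).toFinset,
        kernelBorelTail ν 𝓕 T f
          (((q.out : (quasiSplit F E c 3).arithmeticSubgroup) : (quasiSplit F E c 3).Adelic) * x) := by
  rw [truncatedKernel_def, pseudoEisenstein_def, finsum_eq_sum _ (finite_support_kernelBorelTail_translate ν 𝓕 hT f x)]

end DeltaSum

/-! ## §4 A pointwise threshold: `H(γ x) ≤ H_mat(x⁻¹)` for every `γ ∈ G(F)`, so `k^T(x) = K(x, x)`
and `Λ^T φ(x) = φ(x)` once `T ≥ H_mat(x⁻¹)` (every `N`) -/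

section Threshold

variable {N : ℕ} [NeZero N]

/-- **The heights `H(γ x)`, `γ ∈ G(F)`, are bounded by a constant depending only on `x`**:
`H(γ x) = h(e_N γ · x)⁻¹ ≤ H_mat(x⁻¹)`, since the heights of the non-zero vectors of the lattice
`E^N · x` are bounded below by `H_mat(x⁻¹)⁻¹` (★ `one_le_matHeightBound_mul_vecHeight`; Garrett
(2018), Cor. 3.3.3; Godement, Sém. Bourbaki 257 §1.1 (iv)). [cite: Garrett2018, Cor. 3.3.3 (PDF p. 163)] -/
theorem borelHeight_rational_mul_le (γ : (quasiSplit F E c N).arithmeticSubgroup) (x : (quasiSplit F E c N).Adelic) :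
    borelHeight ((γ : (quasiSplit F E c N).Adelic) * x) ≤
      matHeightBound E (((adelicVal F E c N _ x)⁻¹ : GL (Fin N) (AdeleRing (𝓞 E) E)) :
        Matrix (Fin N) (Fin N) (AdeleRing (𝓞 E) E)) := by
  obtain ⟨ρ, hρ⟩ := γ.2
  have h1 := one_le_matHeightBound_mul_vecHeight (K := E) (lastRow_rational_ne_zero ρ) (adelicVal F E c N _ x)
  rw [borelHeight_def, ← hρ, lastRow_mul, lastRow_toAdelic]
  set h := vecHeight E (principalVec E (fun j : Fin N => ((ρ.1 : GL (Fin N) E) : Matrix (Fin N) (Fin N) E) ⊤ j) ᵥ*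
    ((adelicVal F E c N _ x : GL (Fin N) (AdeleRing (𝓞 E) E)) : Matrix (Fin N) (Fin N) (AdeleRing (𝓞 E) E))) with hh
  set M := matHeightBound E (((adelicVal F E c N _ x)⁻¹ : GL (Fin N) (AdeleRing (𝓞 E) E)) :
    Matrix (Fin N) (Fin N) (AdeleRing (𝓞 E) E)) with hM
  by_cases h0 : h = 0
  · rw [h0, _root_.inv_zero]; exact bot_le
  · rw [inv_le_iff_one_le_mul₀ (pos_iff_ne_zero.2 h0)]
    simpa only [mul_comm] using h1

variable [MeasurableSpace (adelicUnipotent F E c N)]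

/-- **`k^T(x) = K(x, x)` as soon as `T ≥ H_mat(x⁻¹)`** — a pointwise, explicit version of «for `x` in
a fixed compact set and `T` large, `k^T(x) = K(x, x)`» (Shokranian (1992), Example (5.2)): no
translate `γ x` has height above `T` (`borelHeight_rational_mul_le`, ★ `truncatedKernel_eq_kernel_of_forall_le`).
[cite: Shokranian1992, §5.1 Example (5.2)] -/
theorem truncatedKernel_eq_kernel_of_matHeightBound_le (ν : Measure (adelicUnipotent F E c N))
    (𝓕 : Set (adelicUnipotent F E c N)) {T : ℝ≥0} (f : (quasiSplit F E c N).Adelic → ℂ)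
    {x : (quasiSplit F E c N).Adelic}
    (hT : matHeightBound E (((adelicVal F E c N _ x)⁻¹ : GL (Fin N) (AdeleRing (𝓞 E) E)) :
        Matrix (Fin N) (Fin N) (AdeleRing (𝓞 E) E)) ≤ T) :
    truncatedKernel ν 𝓕 T f x = kernel f x x :=
  truncatedKernel_eq_kernel_of_forall_le f fun γ => (borelHeight_rational_mul_le γ x).trans hT

/-- **`Λ^T φ(x) = φ(x)` as soon as `T ≥ H_mat(x⁻¹)`**: no term of the pseudo-Eisenstein sum of the
tail `c_B^T φ` survives at `x` (Garrett (2018), §2.10). [cite: Garrett2018, §2.10 (PDF p. 119)] -/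
theorem truncation_eq_self_of_matHeightBound_le (ν : Measure (adelicUnipotent F E c N))
    (𝓕 : Set (adelicUnipotent F E c N)) {T : ℝ≥0} (φ : (quasiSplit F E c N).Adelic → ℂ)
    {x : (quasiSplit F E c N).Adelic}
    (hT : matHeightBound E (((adelicVal F E c N _ x)⁻¹ : GL (Fin N) (AdeleRing (𝓞 E) E)) :
        Matrix (Fin N) (Fin N) (AdeleRing (𝓞 E) E)) ≤ T) :
    truncation ν 𝓕 T φ x = φ x := by
  rw [truncation_def, pseudoEisenstein_def, sub_eq_self]
  refine finsum_eq_zero_of_forall_eq_zero fun q => ?_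
  exact constantTermTail_of_not_lt _ (not_lt.2 ((borelHeight_rational_mul_le _ x).trans hT))

end Threshold

end UnitaryGroup

end Literature.NumberTheory.Automorphic
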